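import Literature.AlgebraicGeometry.HodgeTheory.QuaternionicQuarticFamilyDeckHolds
import Literature.AlgebraicGeometry.HodgeTheory.BettiUniverseAxioms
import Literature.Algebra.Lie.KatzRecognitionTheorems
import HarnessLib

/-!
# K1Q skeleton `mechanism-v2`, stub S6 `stub_familyDeckExistsQ` — discharged BY NAME modulo Kollár's functorial resolution

Route `HodgeConjecture/Q8SymplecticPowers`, crux K1Q `VeryGeneralQuaternionCommutatorsInHg` (stmt-HodgeConjecture-24190), line
`mechanism-v2` (planner hodge-nonav-p3 g36, registered 2026-08-29T11:44Z). Written by the prover seat `hodge-nonav-prover-Bx` (g19),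
programme M1. The registered stub S6 is, verbatim, `Q8Family.Q8FamilyDeck e` for every even `e ≥ 4`; programme M1 proves
`Q8Family.q8FamilyDeck_holds : Kollar2007_resolutionLiftsAutomorphisms → ∀ e ≥ 2, Q8FamilyDeck e`, so S6 holds CONDITIONALLY on the
named fact `Literature.AlgebraicGeometry.Resolution.Kollar2007_resolutionLiftsAutomorphisms` (Kollár 2007, Thm. 3.36 with §3.4.1:
the functorial resolution commutes with automorphisms) — the hypothesis `hK` below; nothing else is assumed.

Honest scope: a conditional discharge of ONE stub of a skeleton; K1Q and HC are NOT proved here.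
-/

set_option linter.dupNamespace false

namespace Summit.HodgeConjecture.HodgeConjecture.Theorems.Q8SymplecticPowersFamilyDeck

/-- **S6 `stub_familyDeckExistsQ` modulo Kollár 3.36/§3.4.1** (`Kollar2007_resolutionLiftsAutomorphisms → S6`, the
consequent being the registered stub verbatim): for every even `e ≥ 4` the quaternionic quartic family admits a
smooth projective family model over a non-empty open of the parameter space carrying the deck pair `(τ, j)` (`τ⁴ = 1`, `j² = τ²`,
`τ j τ = j`) and the explicit étale chart, equivariantly and fibrewise densely (statement = the registered stub, verbatim;
proof = `Q8Family.q8FamilyDeck_holds`). [cite: Kollar2007, Thm. 3.36 and §3.4.1] [cite: EGAIV3, Thm. 8.10.5] -/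
theorem stub_familyDeckExistsQ_of_kollar :
    Literature.AlgebraicGeometry.Resolution.Kollar2007_resolutionLiftsAutomorphisms.{0} →
    open Literature.AlgebraicGeometry.Motives Literature.AlgebraicGeometry.HodgeTheory Literature.AlgebraicGeometry.HodgeTheory.BettiUniverse Literature.AlgebraicGeometry.HodgeTheory.Q8Family Literature.AlgebraicGeometry.RelativeSpec Literature.AlgebraicGeometry.RelativeSpec.ActionOver Literature.Algebra.Lie Literature.Algebra.Lie.KatzRecognition CategoryTheory CategoryTheory.Limits MonoidalCategory CartesianMonoidalCategory AlgebraicGeometry in ∀ ⦃e : ℕ⦄, Even e → 4 ≤ e → ∃ (W : (Spec (.of (ParamRing e))).Opens) (𝒳 : SchemeOver ℂ) (π : 𝒳 ⟶ base W) (τ j : 𝒳 ⟶ 𝒳) (ι : (deckChart (fun i => (MvPolynomial.X i : ParamRing e)) ⊗ Over.mk W.ι).left ⟶ 𝒳.left), Nonempty (ComplexPoints (base W)) ∧ IsSmoothProjectiveFamily π 2 ∧ IsQuasiProjectiveOver 𝒳 ∧ IsQuasiProjectiveOver (base W) ∧ AlgebraicGeometry.SmoothOfRelativeDimension (Fintype.card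 (CIdx e)) (base W).hom ∧ (τ ≫ π = π ∧ j ≫ π = π ∧ τ ≫ τ ≫ τ ≫ τ = 𝟙 𝒳 ∧ j ≫ j = τ ≫ τ ∧ τ ≫ j ≫ τ = j) ∧ IsOpenImmersion ι ∧ ι ≫ π.left = (snd (deckChart (fun i => (MvPolynomial.X i : ParamRing e))) (Over.mk W.ι)).left ∧ ((Over.isoMk ((deckAction (fun i => (MvPolynomial.X i : ParamRing e))).aut (QuaternionGroup.a 1)) ((deckAction (fun i => (MvPolynomial.X i : ParamRing e))).aut_comp (QuaternionGroup.a 1))).hom ▷ Over.mk W.ι).left ≫ ι = ι ≫ τ.left ∧ ((Over.isoMk ((deckAction (fun i => (MvPolynomial.X i : ParamRing e))).aut (QuaternionGroup.xa 0)) ((deckAction (fun i => (MvPolynomial.X i : ParamRing e))).aut_comp (QuaternionGroup.xa 0))).hom ▷ Over.mk W.ι).left ≫ ι = ι ≫ j.left ∧ Function.Surjective (snd (deckChart (fun i => (MvPolynomial.X i : ParamRing e))) (Over.mk W.ι)).left := by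
  intro hK e _ h4
  exact Literature.AlgebraicGeometry.HodgeTheory.Q8Family.q8FamilyDeck_holds hK e (by omega)

end Summit.HodgeConjecture.HodgeConjecture.Theorems.Q8SymplecticPowersFamilyDeck
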